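import Mathlib
import HarnessLib

/-!
# Peres's theorem: noise sensitivity of linear threshold functions (partition form)

Counting-form infrastructure behind Y. Peres's theorem `NS_δ[f] ≤ O(√δ)` for every linear
threshold function `f` (Peres 2004; O'Donnell 2014, §5.5), in the shape in which it is used:

* `unate_sum_card_pivotal_le` — a unate Boolean function on the cube `κ → Bool` (monotone or
  antitone in each coordinate separately) has total influence at most `√|κ|`:
  `Σ_ω #{j : H ω ≠ H (ω with bit j flipped)} ≤ √|κ| · 2^{|κ|}` (O'Donnell 2014, Ex. 2.23:
  `Inf_j = |Ĥ(j)|` for unate `H`, Cauchy–Schwarz, and Bessel `Σ_j Ĥ(j)² ≤ 1`).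
* `sum_card_blockFlip_le_of_unate` — O'Donnell's Theorem 5.35 in partition form: label the
  coordinates of the cube `ι → Bool` by blocks, `P : ι → κ`; if for every base point `ε₀` the
  block-sign function `ω ↦ h (ε₀ ⊕ ω ∘ P)` of `h : (ι → Bool) → Bool` is unate, then flipping one
  whole block changes `h` rarely: `Σ_ε #{j : h ε ≠ h (ε with block P⁻¹(j) flipped)} ≤ √|κ| · 2^{|ι|}`.
* `peres_sum_card_blockFlip_le` — the case of (generalised) linear threshold functions
  `h ε = [θ < Σ_i (if ε i then a i else b i)]`, whose block-sign functions are again threshold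
  functions, hence unate. This is Peres's theorem proper: with `κ = Fin M` and a uniformly random
  labelling `P` the flipped set `P⁻¹(j)` is a `1/M`-random subset, so after averaging over `P` the
  bound reads `NS^{flip}_{1/M}[h] ≤ 1/√M`; the statement here holds for EVERY labelling `P`.

Everything is a finite sum over the cube and is proved; no probability theory is used, and there
are no new definitions (bit flips `Function.update ω j (!ω j)`, block flips and the block
reparametrisation `ε₀ ⊕ ω ∘ P` are written out as lambdas).

## References
* Y. Peres, *Noise stability of weighted majority*, arXiv:math/0412377 (2004); in: In and Out of
  Equilibrium 3, Progr. Probab. 77, Birkhäuser (2021), 677–682, Thm. 1 [Peres2004].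
* R. O'Donnell, *Analysis of Boolean Functions*, Cambridge Univ. Press 2014, Ex. 2.23, Prop. 2.21,
  §5.5 Thm. 5.35 and "Peres's Theorem" [ODonnell2014].
-/

noncomputable section

namespace Literature.Computability.Complexity

open Finset

variable {κ : Type*} [DecidableEq κ]

/-! ### Coordinate characters on the cube `κ → Bool` -/

/-- Flipping bit `j` twice is the identity. [folklore] -/
theorem update_not_update_not (ω : κ → Bool) (j : κ) :
    Function.update (Function.update ω j (!ω j)) j (!(Function.update ω j (!ω j)) j) = ω := by
  ext i
  by_cases hi : i = j
  · subst hi; simp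
  · simp [Function.update_of_ne hi]

/-- A bit flip moves every point. [folklore] -/
theorem update_not_ne (ω : κ → Bool) (j : κ) : Function.update ω j (!ω j) ≠ ω := by
  intro h
  have := congrFun h j
  simp at this

variable [Fintype κ]

/-- **Orthogonality of the coordinate characters**, counting form:
`Σ_ω (±1)^{ω j} (±1)^{ω j'} = 2^{|κ|} · [j = j']`. [cite: ODonnell2014, §1.4] -/
theorem sum_boolSign_mul_boolSign (j j' : κ) :
    ∑ ω : κ → Bool, (if ω j then (1 : ℝ) else -1) * (if ω j' then 1 else -1) =
      if j = j' then (2 : ℝ) ^ Fintype.card κ else 0 := by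
  by_cases hjj : j = j'
  · subst hjj
    rw [if_pos rfl]
    have h : ∀ ω : κ → Bool, (if ω j then (1 : ℝ) else -1) * (if ω j then 1 else -1) = 1 := by
      intro ω; cases ω j <;> norm_num
    simp only [h, sum_const, card_univ, Fintype.card_fun, Fintype.card_bool, nsmul_eq_mul, mul_one]
    push_cast
    ring
  · rw [if_neg hjj]
    have hj'j : j' ≠ j := fun h => hjj h.symm
    refine sum_involution (fun ω _ => Function.update ω j (!ω j)) ?_ ?_ ?_ ?_
    · intro ω _
      simp only [Function.update_self, Function.update_of_ne hj'j]
      cases ω j <;> cases ω j' <;> norm_num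
    · intro ω _ _
      exact update_not_ne ω j
    · intro ω _
      exact mem_univ _
    · intro ω _
      exact update_not_update_not ω j

/-- **Bessel's inequality at level one**, counting form: for every `H : (κ → Bool) → Bool`,
`Σ_j (Σ_ω (±1)^{H ω} (±1)^{ω j})² ≤ 4^{|κ|}`, i.e. `Σ_j Ĥ(j)² ≤ 𝔼[H²] = 1`.
[cite: ODonnell2014, §1.4] -/
theorem sum_sq_sum_boolSign_mul_le (H : (κ → Bool) → Bool) :
    ∑ j : κ, (∑ ω : κ → Bool, (if H ω then (1 : ℝ) else -1) * (if ω j then 1 else -1)) ^ 2 ≤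
      ((2 : ℝ) ^ Fintype.card κ) ^ 2 := by
  set N : ℝ := (2 : ℝ) ^ Fintype.card κ with hN
  set s : (κ → Bool) → ℝ := fun ω => if H ω then (1 : ℝ) else -1 with hs
  set χ : κ → (κ → Bool) → ℝ := fun j ω => if ω j then (1 : ℝ) else -1 with hχ
  set a : κ → ℝ := fun j => ∑ ω, s ω * χ j ω with ha
  have hNpos : 0 < N := by positivity
  have hcard : ((univ : Finset (κ → Bool)).card : ℝ) = N := by
    rw [card_univ, Fintype.card_fun, Fintype.card_bool]; push_cast; rfl
  have hs2 : ∀ ω, s ω ^ 2 = 1 := fun ω => by simp only [hs]; cases H ω <;> norm_num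
  have horth : ∀ j j' : κ, ∑ ω, χ j ω * χ j' ω = if j = j' then N else 0 := fun j j' =>
    sum_boolSign_mul_boolSign j j'
  -- expand `0 ≤ Σ_ω (N s ω − Σ_j a_j χ_j ω)²`
  have hexp : ∑ ω, (N * s ω - ∑ j, a j * χ j ω) ^ 2 = N * (N ^ 2 - ∑ j, a j ^ 2) := by
    have e1 : ∀ ω, (N * s ω - ∑ j, a j * χ j ω) ^ 2 =
        N ^ 2 * s ω ^ 2 - 2 * N * (s ω * ∑ j, a j * χ j ω) + (∑ j, a j * χ j ω) ^ 2 := by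
      intro ω; ring
    simp only [e1, hs2, mul_one, sum_add_distrib, sum_sub_distrib, sum_const, nsmul_eq_mul, hcard]
    -- cross term
    have e2 : ∑ ω, s ω * ∑ j, a j * χ j ω = ∑ j, a j ^ 2 := by
      simp_rw [mul_sum]
      rw [sum_comm]
      refine sum_congr rfl fun j _ => ?_
      rw [sq, show a j * a j = a j * ∑ ω, s ω * χ j ω from rfl, mul_sum]
      exact sum_congr rfl fun ω _ => by ring
    -- square term
    have e3 : ∑ ω, (∑ j, a j * χ j ω) ^ 2 = N * ∑ j, a j ^ 2 := by
      simp_rw [sq, sum_mul_sum]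
      rw [sum_comm]
      rw [mul_sum]
      refine sum_congr rfl fun j _ => ?_
      rw [sum_comm]
      have e4 : ∀ j', ∑ ω, a j * χ j ω * (a j' * χ j' ω) = a j * a j' * ∑ ω, χ j ω * χ j' ω := by
        intro j'; rw [mul_sum]; exact sum_congr rfl fun ω _ => by ring
      simp_rw [e4, horth, mul_ite, mul_zero]
      rw [sum_ite_eq]
      simp only [mem_univ, if_true]
      ring
    rw [← mul_sum, e2, e3]
    ring
  have hnonneg : 0 ≤ N * (N ^ 2 - ∑ j, a j ^ 2) := by
    rw [← hexp]; exact sum_nonneg fun ω _ => sq_nonneg _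
  have : 0 ≤ N ^ 2 - ∑ j, a j ^ 2 := (mul_nonneg_iff_of_pos_left hNpos).1 hnonneg
  linarith

/-! ### Unate functions: pivotal points and level-one coefficients -/

/-- For `H` MONOTONE in coordinate `j`, the number of points where bit `j` is pivotal equals
`Σ_ω (±1)^{H ω} (±1)^{ω j}` exactly (`= 2^{|κ|} Ĥ(j)`; O'Donnell 2014, Prop. 2.21): on a pivotal
point the two signs agree, and the non-pivotal points cancel in flip-pairs.
[cite: ODonnell2014, §2.3 Prop. 2.21] -/
theorem sum_boolSign_mul_eq_card_pivotal_of_monotone (H : (κ → Bool) → Bool) (j : κ)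
    (hmono : ∀ ω, H (Function.update ω j false) = true → H (Function.update ω j true) = true) :
    ∑ ω : κ → Bool, (if H ω then (1 : ℝ) else -1) * (if ω j then 1 else -1) =
      ((univ.filter fun ω : κ → Bool => H ω ≠ H (Function.update ω j (!ω j))).card : ℝ) := by
  set piv : (κ → Bool) → Prop := fun ω => H ω ≠ H (Function.update ω j (!ω j)) with hpiv
  set f : (κ → Bool) → ℝ := fun ω => (if H ω then (1 : ℝ) else -1) * (if ω j then 1 else -1)
    with hf
  -- on a pivotal point, `H ω = ω j`
  have hval : ∀ ω, piv ω → H ω = ω j := by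
    intro ω hω
    simp only [hpiv] at hω
    cases hj : ω j
    · -- flipping sets bit `j` to `true`; monotonicity forbids `H ω = true`
      rw [hj, Bool.not_false] at hω
      by_contra hH
      rw [Bool.not_eq_false] at hH
      have h1 := hmono ω
      rw [show Function.update ω j false = ω by rw [← hj, Function.update_eq_self]] at h1
      exact hω (by rw [hH, h1 hH])
    · rw [hj, Bool.not_true] at hω
      by_contra hH
      rw [Bool.not_eq_true] at hH
      have h1 := hmono (Function.update ω j false)
      simp only [Function.update_idem] at h1
      rw [show Function.update ω j true = ω by rw [← hj, Function.update_eq_self]] at h1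
      cases hH' : H (Function.update ω j false)
      · exact hω (by rw [hH, hH'])
      · exact absurd (h1 hH') (by rw [hH]; decide)
  rw [← sum_filter_add_sum_filter_not univ piv f]
  have hzero : ∑ ω ∈ univ.filter (fun ω => ¬ piv ω), f ω = 0 := by
    refine sum_involution (fun ω _ => Function.update ω j (!ω j)) ?_ ?_ ?_ ?_
    · intro ω hω
      have hω' : H (Function.update ω j (!ω j)) = H ω := by
        have := (mem_filter.1 hω).2
        simp only [hpiv, not_not] at this
        exact this.symm
      simp only [hf, Function.update_self, hω']
      cases ω j <;> cases H ω <;> norm_num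
    · intro ω _ _
      exact update_not_ne ω j
    · intro ω hω
      have := (mem_filter.1 hω).2
      refine mem_filter.2 ⟨mem_univ _, ?_⟩
      simp only [hpiv, not_not, update_not_update_not] at this ⊢
      exact this.symm
    · intro ω _
      exact update_not_update_not ω j
  have hone : ∀ ω ∈ univ.filter piv, f ω = 1 := by
    intro ω hω
    have h := hval ω (mem_filter.1 hω).2
    simp only [hf, h]
    cases ω j <;> norm_num
  rw [hzero, add_zero, sum_congr rfl hone, sum_const, nsmul_eq_mul, mul_one]

/-- For `H` unate in coordinate `j` (monotone or antitone), the number of `j`-pivotal points is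
`|Σ_ω (±1)^{H ω} (±1)^{ω j}| = 2^{|κ|} |Ĥ(j)|`. [cite: ODonnell2014, §2.3 Prop. 2.21] -/
theorem card_pivotal_eq_abs_sum_of_unate (H : (κ → Bool) → Bool) (j : κ)
    (hU : (∀ ω, H (Function.update ω j false) = true → H (Function.update ω j true) = true) ∨
      (∀ ω, H (Function.update ω j true) = true → H (Function.update ω j false) = true)) :
    ((univ.filter fun ω : κ → Bool => H ω ≠ H (Function.update ω j (!ω j))).card : ℝ) =
      |∑ ω : κ → Bool, (if H ω then (1 : ℝ) else -1) * (if ω j then 1 else -1)| := by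
  rcases hU with hmono | hanti
  · rw [sum_boolSign_mul_eq_card_pivotal_of_monotone H j hmono, abs_of_nonneg (Nat.cast_nonneg _)]
  · -- `¬H` is monotone in `j`, has the same pivotal set and the opposite sign sum
    have hmono' : ∀ ω, (!H (Function.update ω j false)) = true →
        (!H (Function.update ω j true)) = true := by
      intro ω h
      rw [Bool.not_eq_true'] at h ⊢
      by_contra h'
      rw [Bool.not_eq_false] at h'
      rw [hanti ω h'] at h
      exact Bool.noConfusion h
    have h1 := sum_boolSign_mul_eq_card_pivotal_of_monotone (fun ω => !H ω) j hmono'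
    have hset : (univ.filter fun ω : κ → Bool => (!H ω) ≠ !H (Function.update ω j (!ω j))) =
        univ.filter fun ω : κ → Bool => H ω ≠ H (Function.update ω j (!ω j)) := by
      refine filter_congr fun ω _ => ?_
      simp
    have hneg : ∑ ω : κ → Bool, (if (!H ω) then (1 : ℝ) else -1) * (if ω j then 1 else -1) =
        -∑ ω : κ → Bool, (if H ω then (1 : ℝ) else -1) * (if ω j then 1 else -1) := by
      rw [← sum_neg_distrib]
      refine sum_congr rfl fun ω _ => ?_
      cases H ω <;> cases ω j <;> norm_num
    rw [hset, hneg] at h1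
    rw [← abs_neg, h1, abs_of_nonneg (Nat.cast_nonneg _)]

/-- **Unate functions have total influence at most `√|κ|`** (O'Donnell 2014, Ex. 2.23), counting
form: if `H : (κ → Bool) → Bool` is monotone or antitone in each coordinate, then
`Σ_ω #{j : H ω ≠ H (ω with bit j flipped)} ≤ √|κ| · 2^{|κ|}`. Proof: `Inf_j[H] = |Ĥ(j)|`,
Cauchy–Schwarz over `j`, and Bessel `Σ_j Ĥ(j)² ≤ 1`. [cite: ODonnell2014, §2.3 Ex. 2.23] -/
theorem unate_sum_card_pivotal_le (H : (κ → Bool) → Bool)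
    (hU : ∀ j : κ,
      (∀ ω, H (Function.update ω j false) = true → H (Function.update ω j true) = true) ∨
      (∀ ω, H (Function.update ω j true) = true → H (Function.update ω j false) = true)) :
    ∑ ω : κ → Bool, ((univ.filter fun j : κ => H ω ≠ H (Function.update ω j (!ω j))).card : ℝ)
      ≤ Real.sqrt (Fintype.card κ) * (2 : ℝ) ^ Fintype.card κ := by
  set N : ℝ := (2 : ℝ) ^ Fintype.card κ with hN
  set a : κ → ℝ := fun j => ∑ ω : κ → Bool, (if H ω then (1 : ℝ) else -1) * (if ω j then 1 else -1)
    with ha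
  -- exchange the two counts
  have hswap : ∑ ω : κ → Bool,
      ((univ.filter fun j : κ => H ω ≠ H (Function.update ω j (!ω j))).card : ℝ) =
      ∑ j : κ, ((univ.filter fun ω : κ → Bool => H ω ≠ H (Function.update ω j (!ω j))).card : ℝ) := by
    simp only [card_eq_sum_ones, Nat.cast_sum, sum_filter]
    rw [sum_comm]
  rw [hswap]
  have habs : ∀ j, ((univ.filter fun ω : κ → Bool =>
      H ω ≠ H (Function.update ω j (!ω j))).card : ℝ) = |a j| := fun j =>
    card_pivotal_eq_abs_sum_of_unate H j (hU j)
  simp only [habs]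
  -- Cauchy–Schwarz and Bessel
  have hCS := sum_mul_sq_le_sq_mul_sq (univ : Finset κ) (fun _ => (1 : ℝ)) (fun j => |a j|)
  simp only [one_pow, sum_const, card_univ, nsmul_eq_mul, mul_one, one_mul, sq_abs] at hCS
  have hB : ∑ j, a j ^ 2 ≤ N ^ 2 := sum_sq_sum_boolSign_mul_le H
  have hK : (0 : ℝ) ≤ Fintype.card κ := Nat.cast_nonneg _
  have hNn : 0 ≤ N := by positivity
  have h2 : (∑ j, |a j|) ^ 2 ≤ (Real.sqrt (Fintype.card κ) * N) ^ 2 := by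
    rw [mul_pow, Real.sq_sqrt hK]
    exact hCS.trans (mul_le_mul_of_nonneg_left hB hK)
  exact abs_le_of_sq_le_sq' h2 (by positivity) |>.2

/-! ### Block flips: O'Donnell's Theorem 5.35 in partition form, and Peres's theorem -/

variable {ι : Type*} [Fintype ι] [DecidableEq ι]

/-- **Theorem 5.35 of O'Donnell 2014, partition form.** Label the coordinates of the cube
`ι → Bool` by blocks, `P : ι → κ`, and suppose that for every base point `ε₀` the block-sign
function `ω ↦ h (ε₀ ⊕ ω ∘ P)` (bit `i` of `ε₀` negated iff `ω (P i)`) is unate on `κ → Bool`. Then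
`Σ_ε #{j : h ε ≠ h (ε with the bits of block P⁻¹(j) flipped)} ≤ √|κ| · 2^{|ι|}`: reparametrise
`ε = ε₀ ⊕ ω ∘ P` (a `2^{|κ|}`-fold cover of the cube), observe that flipping block `j` of `ε` is
flipping bit `j` of `ω`, and apply `unate_sum_card_pivotal_le` fibrewise.
[cite: ODonnell2014, §5.5 Thm. 5.35] -/
theorem sum_card_blockFlip_le_of_unate (h : (ι → Bool) → Bool) (P : ι → κ)
    (hU : ∀ (ε₀ : ι → Bool) (j : κ),
      (∀ ω : κ → Bool,
          h (fun i => if Function.update ω j false (P i) then !ε₀ i else ε₀ i) = true →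
          h (fun i => if Function.update ω j true (P i) then !ε₀ i else ε₀ i) = true) ∨
      (∀ ω : κ → Bool,
          h (fun i => if Function.update ω j true (P i) then !ε₀ i else ε₀ i) = true →
          h (fun i => if Function.update ω j false (P i) then !ε₀ i else ε₀ i) = true)) :
    ∑ ε : ι → Bool, ((univ.filter fun j : κ =>
        h ε ≠ h (fun i => if P i = j then !ε i else ε i)).card : ℝ)
      ≤ Real.sqrt (Fintype.card κ) * (2 : ℝ) ^ Fintype.card ι := by
  set X : (ι → Bool) → ℝ := fun ε =>
    ((univ.filter fun j : κ => h ε ≠ h (fun i => if P i = j then !ε i else ε i)).card : ℝ) with hX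
  -- the block reparametrisation `mix ω ε₀ = ε₀ ⊕ ω ∘ P`
  set mix : (κ → Bool) → (ι → Bool) → (ι → Bool) :=
    fun ω ε₀ i => if ω (P i) then !ε₀ i else ε₀ i with hmix
  have hmix_invol : ∀ ω, Function.Involutive (mix ω) := by
    intro ω ε; ext i; simp only [hmix]; cases ω (P i) <;> simp
  -- flipping block `j` of `mix ω ε₀` is flipping bit `j` of `ω`
  have hflip : ∀ ω ε₀ j, (fun i => if P i = j then !(mix ω ε₀ i) else mix ω ε₀ i) =
      mix (Function.update ω j (!ω j)) ε₀ := by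
    intro ω ε₀ j; ext i
    simp only [hmix]
    by_cases hP : P i = j
    · rw [if_pos hP, hP, Function.update_self]
      cases ε₀ i <;> cases ω j <;> rfl
    · rw [if_neg hP, Function.update_of_ne hP]
  -- each fibre is the pivotal count of a unate function on `κ → Bool`
  have hfib : ∀ ε₀ : ι → Bool, ∑ ω : κ → Bool, X (mix ω ε₀) ≤
      Real.sqrt (Fintype.card κ) * (2 : ℝ) ^ Fintype.card κ := by
    intro ε₀
    have hH := unate_sum_card_pivotal_le (κ := κ) (fun ω => h (mix ω ε₀)) (fun j => hU ε₀ j)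
    refine le_of_eq_of_le (sum_congr rfl fun ω _ => ?_) hH
    simp only [hX, hflip]
  -- `2^{|κ|} Σ_ε X ε = Σ_{ε₀} Σ_ω X (mix ω ε₀)`
  have hcover : ∀ ω : κ → Bool, ∑ ε, X ε = ∑ ε₀, X (mix ω ε₀) := fun ω =>
    (Fintype.sum_equiv (hmix_invol ω).toPerm (fun ε₀ => X (mix ω ε₀)) X fun _ => rfl).symm
  have hsum : (2 : ℝ) ^ Fintype.card κ * ∑ ε, X ε =
      ∑ ε₀ : ι → Bool, ∑ ω : κ → Bool, X (mix ω ε₀) := by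
    rw [sum_comm]
    simp only [← hcover, sum_const, card_univ, Fintype.card_fun, Fintype.card_bool, nsmul_eq_mul]
    push_cast
    ring
  have h2 : (0 : ℝ) < (2 : ℝ) ^ Fintype.card κ := by positivity
  have key : (2 : ℝ) ^ Fintype.card κ * ∑ ε, X ε ≤
      (2 : ℝ) ^ Fintype.card κ * (Real.sqrt (Fintype.card κ) * (2 : ℝ) ^ Fintype.card ι) := by
    rw [hsum]
    calc ∑ ε₀ : ι → Bool, ∑ ω : κ → Bool, X (mix ω ε₀)
        ≤ ∑ _ε₀ : ι → Bool, Real.sqrt (Fintype.card κ) * (2 : ℝ) ^ Fintype.card κ :=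
          sum_le_sum fun ε₀ _ => hfib ε₀
      _ = (2 : ℝ) ^ Fintype.card κ * (Real.sqrt (Fintype.card κ) * (2 : ℝ) ^ Fintype.card ι) := by
          rw [sum_const, card_univ, Fintype.card_fun, Fintype.card_bool, nsmul_eq_mul]
          push_cast
          ring
  exact le_of_mul_le_mul_left key h2

/-- **Peres's theorem, partition form.** For a (generalised) linear threshold function
`h ε = [θ < Σ_i (if ε i then a i else b i)]` on the cube `ι → Bool` and ANY block labelling
`P : ι → κ`: `Σ_ε #{j : h ε ≠ h (ε with block P⁻¹(j) flipped)} ≤ √|κ| · 2^{|ι|}` — the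
block-sign functions of `h` are again threshold functions in `ω` (the block-`j` increment of the
linear form does not depend on `ω`), hence unate. With `κ = Fin M` and `P` uniformly random this
is `NS_{1/M}[h] ≤ M^{-1/2}` (Peres 2004, Thm. 1; O'Donnell 2014, §5.5). [cite: Peres2004, Thm. 1] -/
theorem peres_sum_card_blockFlip_le (h : (ι → Bool) → Bool) (a b : ι → ℝ) (θ : ℝ)
    (hh : ∀ ε, h ε = decide (θ < ∑ i, if ε i then a i else b i)) (P : ι → κ) :
    ∑ ε : ι → Bool, ((univ.filter fun j : κ =>
        h ε ≠ h (fun i => if P i = j then !ε i else ε i)).card : ℝ)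
      ≤ Real.sqrt (Fintype.card κ) * (2 : ℝ) ^ Fintype.card ι := by
  refine sum_card_blockFlip_le_of_unate h P fun ε₀ j => ?_
  -- the linear form along the fibre and its (ω-independent) block-`j` increment
  set L : (κ → Bool) → ℝ := fun ω => ∑ i, if (if ω (P i) then !ε₀ i else ε₀ i) then a i else b i
    with hL
  set C : ℝ := ∑ i ∈ univ.filter (fun i => P i = j), (if ε₀ i then b i - a i else a i - b i)
    with hC
  have hHval : ∀ ω : κ → Bool,
      h (fun i => if ω (P i) then !ε₀ i else ε₀ i) = decide (θ < L ω) := fun ω => by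
    rw [hh]
  have hstep : ∀ ω, L (Function.update ω j true) = L (Function.update ω j false) + C := by
    intro ω
    simp only [hL]
    rw [← sum_filter_add_sum_filter_not univ (fun i => P i = j)
          (fun i => if (if Function.update ω j true (P i) then !ε₀ i else ε₀ i) then a i else b i),
        ← sum_filter_add_sum_filter_not univ (fun i => P i = j)
          (fun i => if (if Function.update ω j false (P i) then !ε₀ i else ε₀ i) then a i else b i)]
    have hsame : ∑ i ∈ univ.filter (fun i => ¬ P i = j),
        (if (if Function.update ω j true (P i) then !ε₀ i else ε₀ i) then a i else b i) =
        ∑ i ∈ univ.filter (fun i => ¬ P i = j),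
        (if (if Function.update ω j false (P i) then !ε₀ i else ε₀ i) then a i else b i) := by
      refine sum_congr rfl fun i hi => ?_
      have hP : P i ≠ j := (mem_filter.1 hi).2
      rw [Function.update_of_ne hP, Function.update_of_ne hP]
    have hdiff : ∑ i ∈ univ.filter (fun i => P i = j),
        (if (if Function.update ω j true (P i) then !ε₀ i else ε₀ i) then a i else b i) =
        ∑ i ∈ univ.filter (fun i => P i = j),
        (if (if Function.update ω j false (P i) then !ε₀ i else ε₀ i) then a i else b i) + C := by
      rw [hC, ← sum_add_distrib]
      refine sum_congr rfl fun i hi => ?_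
      have hP : P i = j := (mem_filter.1 hi).2
      rw [hP, Function.update_self, Function.update_self]
      cases ε₀ i <;> simp
    rw [hsame, hdiff]
    ring
  by_cases hC0 : 0 ≤ C
  · left
    intro ω hω
    rw [hHval, decide_eq_true_eq] at hω ⊢
    rw [hstep]
    linarith
  · right
    intro ω hω
    rw [hHval, decide_eq_true_eq] at hω ⊢
    rw [hstep] at hω
    linarith

end Literature.Computability.Complexity

end
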